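import Summits.ValiantsHypothesis.ValiantsHypothesis.Theorems.FeketeSOSFeketeSOSHardPaleyRIPPairing
import Summits.ValiantsHypothesis.ValiantsHypothesis.Theorems.FeketeSOSFeketeSOSHardGoodReductionTransfer

/-!
# Route FeketeSOS — crux `FeketeSOSHard` (stmt-ValiantsHypothesis-3996), line `paley-rip` (skeleton v3):
# `stub_tameOperator` at rank 2 on SIDON supports

Rank 2 of the registered operator stub `stub_tameOperator` (skeleton `Cruxes/FeketeSOSHard/Lines/paley_rip_v3.lean`)
is PRODUCT TAMENESS: `c₁w₁² + c₂w₂² = a·b` with `a = γ₁w₁ + iγ₂w₂`, `b = γ₁w₁ − iγ₂w₂` (`γ_i² = c_i`), and a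
product is two squares again, `a·b = ((ta+b/t)/2)² − ((ta−b/t)/2)²`, of mass `(t²‖a‖² + ‖b‖²/t²)/2` (P1 of the
census `Lines/paley-rip-stub3-census.md` §4).  On a support `S ⊆ [0,p)` that is SIDON modulo `p`
(`s+t ≡ s'+t'` on `S` only trivially) the cyclic pattern `F` of `a·b` reads `F_{s+t} = a_s b_t + a_t b_s` (`s ≠ t`),
`F_{2s} = a_s b_s`, and the energy identity `Σ_{s,t}|a_s b_t + a_t b_s|² = 2‖a‖²‖b‖² + 2|⟨a,b̄⟩|²` gives
`‖a‖²‖b‖² ≤ 2·#S²·M²` when `|F_n| ≤ M`; balancing `t² = 2#S·M/‖a‖²` then yields squares supported in `S` with the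
same pattern and mass `≤ (3/2)·#S·M`:

* `ztwist_mul`, `pairing_mul_of_dvd`, `coeff_pattern_mul` — dual pairing / coefficient formula for PRODUCTS
  (`F_ν = Σ_{s,t∈S, s+t≡ν} a_s b_t`); `energy_identity_le` — `2‖a‖²‖b‖² ≤ Σ_{s,t∈S}|a_s b_t + a_t b_s|²`;
  `symm_norm_le_of_sidon` — `|a_s b_t + a_t b_s| ≤ 2M` on a Sidon support; `exists_squares_of_mul` — P1 with a
  free balance `t > 0`; `tameOperator_rank_two_of_sidon` — `stub_tameOperator` for `r = 2` on Sidon supports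
  with the explicit bound `2·#S·M` (exponent 1, no `ε`, `K`-free).

So the content of `stub_tameOperator` at `r = 2` lies in supports WITH additive coincidences (census §4, O4).
Honest framing: `r = 2` in general, the engine `stub_paleyFlatRIP` and the crux stay OPEN; `VP ≠ VNP` untouched.
-/

set_option linter.dupNamespace false

namespace Summit.ValiantsHypothesis.ValiantsHypothesis.Theorems.FeketeSOSHardPaleyRIP

open Polynomial Finset
open scoped BigOperators ComplexConjugate

noncomputable section

section Products

variable (p : ℕ) [Fact p.Prime] (z : ZMod p → ℂ)

/-- On a product, `L_z(a·b) = Σ_{s ∈ supp a} Σ_{t ∈ supp b} z(s+t) a_s b_t`. [folklore] -/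
theorem ztwist_mul (a b : ℂ[X]) :
    (Polynomial.lsum (fun e : ℕ => (z (e : ZMod p)) • (LinearMap.id : ℂ →ₗ[ℂ] ℂ)) : ℂ[X] →ₗ[ℂ] ℂ) (a * b) =
      ∑ s ∈ a.support, ∑ t ∈ b.support, z ((s + t : ℕ) : ZMod p) * a.coeff s * b.coeff t := by
  have ha : a = ∑ s ∈ a.support, C (a.coeff s) * X ^ s := as_sum_support_C_mul_X_pow a
  have hb : b = ∑ t ∈ b.support, C (b.coeff t) * X ^ t := as_sum_support_C_mul_X_pow b
  conv_lhs => rw [ha, hb, Finset.sum_mul]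
  simp_rw [Finset.mul_sum]
  rw [map_sum]
  simp_rw [map_sum]
  refine Finset.sum_congr rfl fun s _ => Finset.sum_congr rfl fun t _ => ?_
  have hmul : C (a.coeff s) * X ^ s * (C (b.coeff t) * X ^ t) = C (a.coeff s * b.coeff t) * X ^ (s + t) := by
    rw [map_mul, pow_add]; ring
  rw [hmul, ztwist_C_mul_X_pow]
  ring

/-- The dual pairing for a product: `Σ_{n<p} z(n) F_n = Σ_{s∈supp a}Σ_{t∈supp b} z(s+t) a_s b_t` whenever
`deg F < p` and `X^p − 1 ∣ a·b − F`. [folklore] -/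
theorem pairing_mul_of_dvd (a b F : ℂ[X]) (hF : F.natDegree < p)
    (hdvd : (X : ℂ[X]) ^ p - 1 ∣ a * b - F) :
    ∑ n ∈ range p, z (n : ZMod p) * F.coeff n =
      ∑ s ∈ a.support, ∑ t ∈ b.support, z ((s + t : ℕ) : ZMod p) * a.coeff s * b.coeff t := by
  have h0 := ztwist_eq_zero_of_dvd p z hdvd
  rw [map_sub, sub_eq_zero, ztwist_of_natDegree_lt p z hF, ztwist_mul] at h0
  exact h0.symm

end Products

section Pattern

variable (p : ℕ) [Fact p.Prime]

/-- **Coefficient formula for the cyclic pattern of a product** on a set `S ⊆ [0,p)` containing both supports: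
`F_ν = Σ_{s,t ∈ S, s+t ≡ ν} a_s b_t`. [folklore] -/
theorem coeff_pattern_mul (S : Finset ℕ) (a b F : ℂ[X]) (ha : a.support ⊆ S) (hb : b.support ⊆ S)
    (hF : F.natDegree < p) (hdvd : (X : ℂ[X]) ^ p - 1 ∣ a * b - F) (ν : ZMod p) :
    F.coeff ν.val =
      ∑ s ∈ S, ∑ t ∈ S, if ((s + t : ℕ) : ZMod p) = ν then a.coeff s * b.coeff t else 0 := by
  classical
  have h := pairing_mul_of_dvd p (fun m => if m = ν then 1 else 0) a b F hF hdvd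
  have hl : ∑ m ∈ range p, (if ((m : ℕ) : ZMod p) = ν then (1 : ℂ) else 0) * F.coeff m = F.coeff ν.val := by
    rw [Finset.sum_eq_single ν.val]
    · simp
    · intro m hm hne
      have : ((m : ℕ) : ZMod p) ≠ ν := by
        intro hmn
        apply hne
        rw [← hmn, ZMod.val_natCast, Nat.mod_eq_of_lt (mem_range.1 hm)]
      simp [this]
    · intro hn
      exact absurd (mem_range.2 (ZMod.val_lt ν)) hn
  rw [hl] at h
  rw [h]
  -- pass from the supports to `S` (the extra terms vanish)
  have hinner : ∀ s, ∑ t ∈ b.support, (if ((s + t : ℕ) : ZMod p) = ν then (1 : ℂ) else 0) * a.coeff s * b.coeff t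
      = ∑ t ∈ S, if ((s + t : ℕ) : ZMod p) = ν then a.coeff s * b.coeff t else 0 := by
    intro s
    rw [← Finset.sum_subset hb]
    · refine Finset.sum_congr rfl fun t _ => ?_
      split_ifs <;> ring
    · intro t _ ht
      simp [notMem_support_iff.1 ht]
  rw [Finset.sum_congr rfl fun s _ => hinner s]
  rw [← Finset.sum_subset ha]
  intro s _ hs
  refine Finset.sum_eq_zero fun t _ => ?_
  rw [notMem_support_iff.1 hs]
  split_ifs <;> simp

/-- **Sidon supports: the symmetrised products are pattern values.**  If `S ⊆ [0,p)` is Sidon modulo `p`,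
`supp a, supp b ⊆ S`, `deg F < p`, `X^p − 1 ∣ a·b − F` and `|F_n| ≤ M` for all `n`, then
`|a_s b_t + a_t b_s| ≤ 2M` for all `s, t ∈ S`. [folklore] -/
theorem symm_norm_le_of_sidon (S : Finset ℕ)
    (hSidon : ∀ s ∈ S, ∀ t ∈ S, ∀ s' ∈ S, ∀ t' ∈ S,
      ((s + t : ℕ) : ZMod p) = ((s' + t' : ℕ) : ZMod p) → (s = s' ∧ t = t') ∨ (s = t' ∧ t = s'))
    (a b F : ℂ[X]) (ha : a.support ⊆ S) (hb : b.support ⊆ S) (hF : F.natDegree < p)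
    (hdvd : (X : ℂ[X]) ^ p - 1 ∣ a * b - F) (M : ℝ) (hM : ∀ n, ‖F.coeff n‖ ≤ M)
    {s t : ℕ} (hs : s ∈ S) (ht : t ∈ S) :
    ‖a.coeff s * b.coeff t + a.coeff t * b.coeff s‖ ≤ 2 * M := by
  classical
  have hM0 : 0 ≤ M := (norm_nonneg _).trans (hM 0)
  set ν : ZMod p := ((s + t : ℕ) : ZMod p) with hν
  have hcoef := coeff_pattern_mul p S a b F ha hb hF hdvd ν
  -- rewrite the double sum as a sum over `S ×ˢ S`
  rw [← Finset.sum_product' (f := fun s' t' =>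
      if ((s' + t' : ℕ) : ZMod p) = ν then a.coeff s' * b.coeff t' else 0)] at hcoef
  by_cases hst : s = t
  · -- diagonal: the fibre is `{(s,s)}`
    subst hst
    have hval : F.coeff ν.val = a.coeff s * b.coeff s := by
      rw [hcoef, Finset.sum_eq_single_of_mem (s, s) (Finset.mem_product.2 ⟨hs, hs⟩)]
      · simp [hν]
      · rintro ⟨s', t'⟩ hmem hne
        obtain ⟨hs', ht'⟩ := Finset.mem_product.1 hmem
        split_ifs with h
        · exfalso
          rcases hSidon s' hs' t' ht' s hs s hs (by rw [h, hν]) with ⟨h1, h2⟩ | ⟨h1, h2⟩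
          · exact hne (Prod.ext h1 h2)
          · exact hne (Prod.ext h1 h2)
        · rfl
    calc ‖a.coeff s * b.coeff s + a.coeff s * b.coeff s‖ = 2 * ‖F.coeff ν.val‖ := by
          rw [hval, ← two_mul, norm_mul, Complex.norm_two]
      _ ≤ 2 * M := by linarith [hM ν.val]
  · -- off-diagonal: the fibre is `{(s,t),(t,s)}`
    have hne : (s, t) ≠ (t, s) := fun h => hst (Prod.mk.inj h).1
    have hval : F.coeff ν.val = a.coeff s * b.coeff t + a.coeff t * b.coeff s := by
      rw [hcoef, Finset.sum_eq_add_of_mem (s, t) (t, s) (Finset.mem_product.2 ⟨hs, ht⟩)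
        (Finset.mem_product.2 ⟨ht, hs⟩) hne]
      · simp [hν, add_comm]
      · rintro ⟨s', t'⟩ hmem hne'
        obtain ⟨hs', ht'⟩ := Finset.mem_product.1 hmem
        split_ifs with h
        · exfalso
          rcases hSidon s' hs' t' ht' s hs t ht (by rw [h, hν]) with ⟨h1, h2⟩ | ⟨h1, h2⟩
          · exact hne'.1 (Prod.ext h1 h2)
          · exact hne'.2 (Prod.ext h1 h2)
        · rfl
    calc ‖a.coeff s * b.coeff t + a.coeff t * b.coeff s‖ = ‖F.coeff ν.val‖ := by rw [hval]
      _ ≤ M := hM _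
      _ ≤ 2 * M := by linarith

end Pattern

section Energy

/-- **The energy inequality** (the identity `Σ_{s,t}|a_s b_t + a_t b_s|² = 2‖a‖²‖b‖² + 2|Σ_s a_s \bar b_s|²` with
the last term dropped): `2(Σ_s|a_s|²)(Σ_t|b_t|²) ≤ Σ_{s,t∈S}|a_s b_t + a_t b_s|²`. [folklore] -/
theorem energy_identity_le (S : Finset ℕ) (a b : ℕ → ℂ) :
    2 * (∑ s ∈ S, ‖a s‖ ^ 2) * (∑ t ∈ S, ‖b t‖ ^ 2) ≤
      ∑ s ∈ S, ∑ t ∈ S, ‖a s * b t + a t * b s‖ ^ 2 := by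
  -- expand `|u + v|² = |u|² + |v|² + 2 Re(u \bar v)`
  have hexp : ∀ s t, ‖a s * b t + a t * b s‖ ^ 2 =
      ‖a s‖ ^ 2 * ‖b t‖ ^ 2 + ‖a t‖ ^ 2 * ‖b s‖ ^ 2 +
        2 * ((a s * conj (b s)) * conj (a t * conj (b t))).re := by
    intro s t
    rw [← Complex.normSq_eq_norm_sq, Complex.normSq_add, Complex.normSq_eq_norm_sq, Complex.normSq_eq_norm_sq,
      norm_mul, norm_mul, mul_pow, mul_pow]
    congr 2
    simp only [map_mul, Complex.conj_conj]
    ring_nf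
  have hsplit : ∑ s ∈ S, ∑ t ∈ S, ‖a s * b t + a t * b s‖ ^ 2 =
      (∑ s ∈ S, ∑ t ∈ S, ‖a s‖ ^ 2 * ‖b t‖ ^ 2) + (∑ s ∈ S, ∑ t ∈ S, ‖a t‖ ^ 2 * ‖b s‖ ^ 2) +
        ∑ s ∈ S, ∑ t ∈ S, 2 * ((a s * conj (b s)) * conj (a t * conj (b t))).re := by
    simp_rw [hexp, Finset.sum_add_distrib]
  have hT1 : ∑ s ∈ S, ∑ t ∈ S, ‖a s‖ ^ 2 * ‖b t‖ ^ 2 = (∑ s ∈ S, ‖a s‖ ^ 2) * (∑ t ∈ S, ‖b t‖ ^ 2) :=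
    (Finset.sum_mul_sum _ _ _ _).symm
  have hT2 : ∑ s ∈ S, ∑ t ∈ S, ‖a t‖ ^ 2 * ‖b s‖ ^ 2 = (∑ s ∈ S, ‖a s‖ ^ 2) * (∑ t ∈ S, ‖b t‖ ^ 2) := by
    rw [Finset.sum_comm]
    exact (Finset.sum_mul_sum _ _ _ _).symm
  -- the cross term is `2·|Σ_s a_s \bar b_s|² ≥ 0`
  have hcross : ∑ s ∈ S, ∑ t ∈ S, ((a s * conj (b s)) * conj (a t * conj (b t))).re =
      Complex.normSq (∑ s ∈ S, a s * conj (b s)) := by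
    have h1 : (Complex.normSq (∑ s ∈ S, a s * conj (b s)) : ℝ) =
        ((∑ s ∈ S, a s * conj (b s)) * conj (∑ t ∈ S, a t * conj (b t))).re := by
      rw [Complex.mul_conj, Complex.ofReal_re]
    rw [h1, map_sum, Finset.sum_mul_sum, Complex.re_sum]
    exact Finset.sum_congr rfl fun s _ => (Complex.re_sum _ _).symm
  have hT3 : ∑ s ∈ S, ∑ t ∈ S, 2 * ((a s * conj (b s)) * conj (a t * conj (b t))).re =
      2 * Complex.normSq (∑ s ∈ S, a s * conj (b s)) := by
    simp_rw [← Finset.mul_sum]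
    rw [hcross]
  rw [hsplit, hT1, hT2, hT3]
  nlinarith [Complex.normSq_nonneg (∑ s ∈ S, a s * conj (b s))]

end Energy

section Assembly

variable (p : ℕ) [Fact p.Prime]

/-- `supp (C x · f + C y · g) ⊆ S` when `supp f, supp g ⊆ S` (tree lemma `grt_support_C_mul_subset`). [folklore] -/
theorem support_lin_subset {S : Finset ℕ} (x y : ℂ) (f g : ℂ[X]) (hf : f.support ⊆ S) (hg : g.support ⊆ S) :
    (C x * f + C y * g).support ⊆ S :=
  (support_add.trans (Finset.union_subset ((FeketeSOSHardSketch.grt_support_C_mul_subset x f).trans hf)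
    ((FeketeSOSHardSketch.grt_support_C_mul_subset y g).trans hg)))

omit [Fact p.Prime] in
/-- A multiple of `X^p − 1` of degree `< p` vanishes. [folklore] -/
theorem eq_zero_of_dvd_of_lt {G : ℂ[X]} (hG : G.natDegree < p) (hdvd : (X : ℂ[X]) ^ p - 1 ∣ G) : G = 0 := by
  by_contra hne
  have h := natDegree_le_of_dvd hdvd hne
  have hdeg : ((X : ℂ[X]) ^ p - 1).natDegree = p := by
    rw [← C_1, natDegree_X_pow_sub_C]
  rw [hdeg] at h
  omega

omit [Fact p.Prime] in
/-- **P1 — a product is two squares, with a free balance parameter.**  If `supp a, supp b ⊆ S` and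
`X^p − 1 ∣ a·b − F`, then for every `t > 0` the squares `((ta + b/t)/2)²`, `−((ta − b/t)/2)²` are supported in
`S`, carry the pattern `F`, and have total mass `≤ (t²·Σ_{s∈S}|a_s|² + Σ_{s∈S}|b_s|²/t²)/2`. [folklore] -/
theorem exists_squares_of_mul (S : Finset ℕ) (a b F : ℂ[X]) (ha : a.support ⊆ S) (hb : b.support ⊆ S)
    (hdvd : (X : ℂ[X]) ^ p - 1 ∣ a * b - F) (t : ℝ) (ht : 0 < t) :
    ∃ (c' : Fin 2 → ℂ) (w' : Fin 2 → ℂ[X]), (∀ j, (w' j).support ⊆ S) ∧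
      ((X : ℂ[X]) ^ p - 1 ∣ (∑ j, C (c' j) * w' j ^ 2) - F) ∧
      (∑ j, sqMass (c' j) (w' j)) ≤
        (t ^ 2 * (∑ s ∈ S, ‖a.coeff s‖ ^ 2) + (∑ s ∈ S, ‖b.coeff s‖ ^ 2) / t ^ 2) / 2 := by
  classical
  set x : ℂ := ((t / 2 : ℝ) : ℂ) with hx
  set y : ℂ := ((1 / (2 * t) : ℝ) : ℂ) with hy
  set w0 : ℂ[X] := C x * a + C y * b with hw0
  set w1 : ℂ[X] := C x * a + C (-y) * b with hw1
  have hnx : ‖x‖ = t / 2 := by rw [hx, Complex.norm_real, Real.norm_eq_abs, abs_of_pos (by positivity)]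
  have hny : ‖y‖ = 1 / (2 * t) := by rw [hy, Complex.norm_real, Real.norm_eq_abs, abs_of_pos (by positivity)]
  have hxy : (4 : ℂ[X]) * (C x * C y) = 1 := by
    rw [← map_mul, show (4 : ℂ[X]) = C (4 : ℂ) from (map_ofNat C 4).symm, ← map_mul, hx, hy]
    have ht' : (t : ℂ) ≠ 0 := by exact_mod_cast ht.ne'
    have : (4 : ℂ) * (((t / 2 : ℝ) : ℂ) * ((1 / (2 * t) : ℝ) : ℂ)) = 1 := by
      push_cast
      field_simp
      ring
    rw [this, map_one]
  refine ⟨![1, -1], ![w0, w1], ?_, ?_, ?_⟩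
  · intro j
    fin_cases j
    · exact support_lin_subset x y a b ha hb
    · exact support_lin_subset x (-y) a b ha hb
  · have hid : (∑ j : Fin 2, C ((![1, -1] : Fin 2 → ℂ) j) * (![w0, w1] : Fin 2 → ℂ[X]) j ^ 2) = a * b := by
      rw [Fin.sum_univ_two]
      simp only [Matrix.cons_val_zero, Matrix.cons_val_one, map_one, map_neg, one_mul, hw0, hw1]
      linear_combination (a * b) * hxy
    rw [hid]; exact hdvd
  · -- mass: parallelogram law coefficientwise
    rw [Fin.sum_univ_two]
    simp only [Matrix.cons_val_zero, Matrix.cons_val_one]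
    unfold sqMass
    rw [norm_one, norm_neg, norm_one, one_mul, one_mul]
    have h0 : ∑ n ∈ w0.support, ‖w0.coeff n‖ ^ 2 ≤ ∑ n ∈ S, ‖w0.coeff n‖ ^ 2 :=
      Finset.sum_le_sum_of_subset_of_nonneg (support_lin_subset x y a b ha hb) fun _ _ _ => sq_nonneg _
    have h1 : ∑ n ∈ w1.support, ‖w1.coeff n‖ ^ 2 ≤ ∑ n ∈ S, ‖w1.coeff n‖ ^ 2 :=
      Finset.sum_le_sum_of_subset_of_nonneg (support_lin_subset x (-y) a b ha hb) fun _ _ _ => sq_nonneg _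
    have hpar : ∀ n, ‖w0.coeff n‖ ^ 2 + ‖w1.coeff n‖ ^ 2 =
        t ^ 2 * ‖a.coeff n‖ ^ 2 / 2 + ‖b.coeff n‖ ^ 2 / t ^ 2 / 2 := by
      intro n
      have e0 : w0.coeff n = x * a.coeff n + y * b.coeff n := by
        rw [hw0, coeff_add, coeff_C_mul, coeff_C_mul]
      have e1 : w1.coeff n = x * a.coeff n - y * b.coeff n := by
        rw [hw1, coeff_add, coeff_C_mul, coeff_C_mul]; ring
      have hplaw := parallelogram_law_with_norm ℂ (x * a.coeff n) (y * b.coeff n)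
      rw [← e0, ← e1] at hplaw
      rw [norm_mul, norm_mul, hnx, hny] at hplaw
      have ht0 : t ≠ 0 := ht.ne'
      rw [hplaw]
      field_simp
    calc ∑ n ∈ w0.support, ‖w0.coeff n‖ ^ 2 + ∑ n ∈ w1.support, ‖w1.coeff n‖ ^ 2
        ≤ ∑ n ∈ S, ‖w0.coeff n‖ ^ 2 + ∑ n ∈ S, ‖w1.coeff n‖ ^ 2 := add_le_add h0 h1
      _ = ∑ n ∈ S, (t ^ 2 * ‖a.coeff n‖ ^ 2 / 2 + ‖b.coeff n‖ ^ 2 / t ^ 2 / 2) := by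
          rw [← Finset.sum_add_distrib]; exact Finset.sum_congr rfl fun n _ => hpar n
      _ = (t ^ 2 * (∑ s ∈ S, ‖a.coeff s‖ ^ 2) + (∑ s ∈ S, ‖b.coeff s‖ ^ 2) / t ^ 2) / 2 := by
          rw [Finset.sum_add_distrib, ← Finset.sum_div, ← Finset.sum_div, ← Finset.mul_sum, ← Finset.sum_div]
          ring


/-- **`stub_tameOperator` at rank 2 on Sidon supports (exponent 1, explicit constant).**  Let `S ⊆ [0,p)` be
Sidon modulo `p`.  For every pair of weighted squares `(c_i, w_i)_{i<2}` supported in `S` whose cyclic pattern `F`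
(`deg F < p`, `X^p − 1 ∣ c₀w₀² + c₁w₁² − F`) has coefficients of modulus `≤ M`, there are weighted squares
supported in `S` with the same cyclic pattern and total mass `≤ 2·#S·M`.  Proof: `c₀w₀² + c₁w₁² = a·b` with
`a = γ₀w₀ + iγ₁w₁`, `b = γ₀w₀ − iγ₁w₁`; Sidon ⇒ `|a_s b_t + a_t b_s| ≤ 2M`; energy ⇒ `‖a‖²‖b‖² ≤ 2#S²M²`;
balance `t² = 2#S·M/‖a‖²` in P1. [folklore] -/
theorem tameOperator_rank_two_of_sidon (S : Finset ℕ)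
    (hSidon : ∀ s ∈ S, ∀ t ∈ S, ∀ s' ∈ S, ∀ t' ∈ S,
      ((s + t : ℕ) : ZMod p) = ((s' + t' : ℕ) : ZMod p) → (s = s' ∧ t = t') ∨ (s = t' ∧ t = s'))
    (c : Fin 2 → ℂ) (w : Fin 2 → ℂ[X]) (hw : ∀ i, (w i).support ⊆ S)
    (F : ℂ[X]) (M : ℝ) (hF : F.natDegree < p)
    (hdvd : (X : ℂ[X]) ^ p - 1 ∣ (∑ i, C (c i) * w i ^ 2) - F) (hM : ∀ n, ‖F.coeff n‖ ≤ M) :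
    ∃ (s' : ℕ) (c' : Fin s' → ℂ) (w' : Fin s' → ℂ[X]), (∀ j, (w' j).support ⊆ S) ∧
      ((X : ℂ[X]) ^ p - 1 ∣ (∑ j, C (c' j) * w' j ^ 2) - F) ∧
      (∑ j, sqMass (c' j) (w' j)) ≤ 2 * (S.card : ℝ) * M := by
  classical
  have hM0 : 0 ≤ M := (norm_nonneg _).trans (hM 0)
  -- square roots of the weights and the product form
  obtain ⟨γ0, hγ0⟩ : ∃ γ : ℂ, γ ^ 2 = c 0 := ⟨c 0 ^ ((2 : ℂ)⁻¹), Complex.cpow_nat_inv_pow (c 0) two_ne_zero⟩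
  obtain ⟨γ1, hγ1⟩ : ∃ γ : ℂ, γ ^ 2 = c 1 := ⟨c 1 ^ ((2 : ℂ)⁻¹), Complex.cpow_nat_inv_pow (c 1) two_ne_zero⟩
  set a : ℂ[X] := C γ0 * w 0 + C (Complex.I * γ1) * w 1 with hadef
  set b : ℂ[X] := C γ0 * w 0 + C (-(Complex.I * γ1)) * w 1 with hbdef
  have ha : a.support ⊆ S := support_lin_subset _ _ _ _ (hw 0) (hw 1)
  have hb : b.support ⊆ S := support_lin_subset _ _ _ _ (hw 0) (hw 1)
  have hab : a * b = ∑ i, C (c i) * w i ^ 2 := by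
    rw [Fin.sum_univ_two, ← hγ0, ← hγ1, map_pow, map_pow, hadef, hbdef, map_neg, map_mul]
    have hI : (C Complex.I : ℂ[X]) ^ 2 = -1 := by rw [← map_pow, Complex.I_sq, map_neg, map_one]
    linear_combination (-(C γ1 * w 1) ^ 2) * hI
  have hdvd' : (X : ℂ[X]) ^ p - 1 ∣ a * b - F := by rw [hab]; exact hdvd
  -- the trivial case `F = 0`
  by_cases hF0 : F = 0
  · refine ⟨0, Fin.elim0, Fin.elim0, fun j => Fin.elim0 j, ?_, ?_⟩
    · rw [hF0]; simp
    · simp only [Finset.univ_eq_empty, Finset.sum_empty]; positivity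
  -- `α = Σ|a_s|² > 0`, `M > 0`, `#S ≥ 1`
  set α : ℝ := ∑ s ∈ S, ‖a.coeff s‖ ^ 2 with hαdef
  set β : ℝ := ∑ s ∈ S, ‖b.coeff s‖ ^ 2 with hβdef
  have hα0 : 0 ≤ α := Finset.sum_nonneg fun s _ => sq_nonneg _
  have hβ0 : 0 ≤ β := Finset.sum_nonneg fun s _ => sq_nonneg _
  have hαpos : 0 < α := by
    rcases hα0.lt_or_eq with h | h
    · exact h
    · exfalso
      -- `α = 0` forces `a = 0`, hence `F = 0`
      have hzero : ∀ s ∈ S, a.coeff s = 0 := by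
        intro s hs
        have := (Finset.sum_eq_zero_iff_of_nonneg (fun s _ => sq_nonneg ‖a.coeff s‖)).1 h.symm s hs
        exact norm_eq_zero.1 ((pow_eq_zero_iff two_ne_zero).1 this)
      have ha0 : a = 0 := by
        ext s
        by_cases hs : s ∈ a.support
        · exact hzero s (ha hs)
        · exact notMem_support_iff.1 hs
      apply hF0
      refine eq_zero_of_dvd_of_lt p hF ?_
      have : (X : ℂ[X]) ^ p - 1 ∣ -(a * b - F) := dvd_neg.2 hdvd'
      rwa [ha0, zero_mul, zero_sub, neg_neg] at this
  have hMpos : 0 < M := by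
    obtain ⟨n, hn⟩ : ∃ n, F.coeff n ≠ 0 := by
      by_contra hall
      push Not at hall
      exact hF0 (Polynomial.ext fun n => by rw [hall n, coeff_zero])
    exact lt_of_lt_of_le (norm_pos_iff.2 hn) (hM n)
  have hSpos : 0 < (S.card : ℝ) := by
    have : S.Nonempty := by
      by_contra hS
      rw [Finset.not_nonempty_iff_eq_empty] at hS
      rw [hαdef, hS, Finset.sum_empty] at hαpos
      exact lt_irrefl _ hαpos
    exact_mod_cast this.card_pos
  -- energy + Sidon: `α β ≤ 2 #S² M²`
  have hαβ : α * β ≤ 2 * (S.card : ℝ) ^ 2 * M ^ 2 := by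
    have hE := energy_identity_le S (fun s => a.coeff s) (fun s => b.coeff s)
    have hB : ∑ s ∈ S, ∑ t ∈ S, ‖a.coeff s * b.coeff t + a.coeff t * b.coeff s‖ ^ 2 ≤
        ∑ s ∈ S, ∑ t ∈ S, (2 * M) ^ 2 :=
      Finset.sum_le_sum fun s hs => Finset.sum_le_sum fun t ht =>
        pow_le_pow_left₀ (norm_nonneg _) (symm_norm_le_of_sidon p S hSidon a b F ha hb hF hdvd' M hM hs ht) 2
    rw [Finset.sum_const, Finset.sum_const, smul_smul, nsmul_eq_mul, Nat.cast_mul] at hB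
    nlinarith [hE, hB]
  -- balance: `t² = T := 2 #S M / α`
  set T : ℝ := 2 * (S.card : ℝ) * M / α with hTdef
  have hTpos : 0 < T := by positivity
  obtain ⟨c', w', hsupp', hdvd'', hmass⟩ :=
    exists_squares_of_mul p S a b F ha hb hdvd' (Real.sqrt T) (Real.sqrt_pos.2 hTpos)
  refine ⟨2, c', w', hsupp', hdvd'', hmass.trans ?_⟩
  rw [Real.sq_sqrt hTpos.le]
  -- `(Tα + β/T)/2 ≤ (2#SM + #SM)/2 ≤ 2 #S M`
  have hTα : T * α = 2 * (S.card : ℝ) * M := by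
    rw [hTdef]; field_simp
  have hβT : β / T ≤ (S.card : ℝ) * M := by
    rw [div_le_iff₀ hTpos, hTdef]
    rw [show (S.card : ℝ) * M * (2 * (S.card : ℝ) * M / α) = (2 * (S.card : ℝ) ^ 2 * M ^ 2) / α by ring]
    rw [le_div_iff₀ hαpos]
    nlinarith [hαβ]
  rw [← hαdef, ← hβdef, hTα]
  nlinarith [hβT, hSpos, hMpos]

end Assembly

end

end Summit.ValiantsHypothesis.ValiantsHypothesis.Theorems.FeketeSOSHardPaleyRIP
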